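import Mathlib
import Literature.Geometry.Lorentzian.MullerZumHagenAnalyticity
import Literature.Geometry.Lorentzian.NomizuKillingExtension
import Literature.Geometry.Lorentzian.DocStructureTimeFunction
import Literature.Geometry.Lorentzian.DocProductStructure
import Literature.Geometry.Lorentzian.NomizuKillingExtensionChart
import Literature.Geometry.Lorentzian.NearHorizonAxialKilling
import Literature.Geometry.Lorentzian.StationaryNormAtInfinity
import Literature.Geometry.Lorentzian.KillingOnNormInvariance
import Literature.Geometry.Lorentzian.KillingCoherentContinuation
import Literature.Geometry.Lorentzian.ChartwiseAnalyticKillingExtension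
import Literature.Geometry.Lorentzian.KillingOnPeriodicFlow
import Literature.Geometry.Lorentzian.KillingOnConfinedComplete
import Literature.Geometry.Lorentzian.StationaryOrbitConfinement
import Literature.Geometry.Lorentzian.CausalityOpennessProofs
import Literature.Geometry.Lorentzian.DocStaticUniquenessProofs
import Literature.Geometry.Lorentzian.CommutingFlowLocal
import Literature.Geometry.Lorentzian.KillingOnIntegralCurveUnique
import Literature.Geometry.Lorentzian.StationaryOrbitRadialDrift
import Literature.Geometry.Lorentzian.AxialSeedCompleteness
import HarnessLib

/-!
# `NonTrappingHawkingRigidity` (crux stmt-FinalStateConjecture-13896), line `azimuthal-partial-analyticity` —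
# stub `stub_farAxialSeed` (N1, rev 7)

Registered stub N1 of the lead's skeleton (rev 7), namespace
`…Cruxes.NonTrappingHawkingRigidity.AzimuthalPartialAnalyticity`, `Holds.stub_farAxialSeed`, PROVED.
The statement below is the REGISTERED signature, letter for letter (Literature vocabulary only); rev 7 is
the rev-6 statement with the two idle crux binders h15 (belt compact modulo `T`) and h16 (no trapped
zero-energy null geodesic) dropped and the three local-Killing hypothesis pairs (smoothness + Killing
equation of `L₁` on `D₁`, `L₂` on `D₂`, `Z` on `W`) contracted to `PseudoRiemannianMetric.IsKillingFieldOn`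
(definitionally the same conjunction), so that its one-line form stays under the registry's 3900 characters.

**Statement (the far axial seed: a dichotomy).** Granted six named facts as leading hypotheses — the
near-horizon axial dichotomy `alexakisIonescuKlainerman2010_nearHorizonAxialKilling` (`F_rot`), the
asymptotics of `g(T,T)` `chruscielCosta2008_stationaryNormAtInfinity` (`F_lev`), Müller zum Hagen
analyticity `mullerZumHagen1970_analytic_of_timelikeKilling`, the `C^∞` Nomizu extension
`PseudoRiemannianMetric.Nomizu1960_killing_extension`, the Chruściel–Costa equivariant time function and
product structure — every vacuum, `I⁺`-regular, future-presented stationary black hole `𝓑` with the crux's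
binders h1–h14 (Killing–timelike collar `(U, K)` on a connected horizon `𝓔⁺`), NON-DEGENERACY of the collar field (h17: `∇_K K = κ K` on `𝓔⁺`,
`κ ≠ 0`), a radial function `ρ₀` with (R1)–(R6) and preconnected sub-levels (R7), the TIMELIKE REACH
hypothesis (from every far point `{ρ₀ > cF}` the `T`-timelike component of the d.o.c. through it enters
every sub-level `{ρ₀ < c}`) and the KILLING CONTINUATION COHERENCE hypothesis (two local `T`-commuting
Killing fields on open connected subsets of `{g(T,T) < 0} ∪ U` inside the d.o.c., one of them docked to
`span{T, K}` on an open subset of `U`, which agree on a non-empty open set agree on the whole overlap),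
satisfies: EITHER the collar is non-rotating (`K = α T` on the trace `U'' ∩ doc` of an open `U'' ⊇ 𝓔⁺`),
OR there are an open CONNECTED `W ⊆ doc` containing every point of the d.o.c. off the `T`-orbit of a
compact subset of the d.o.c., a `C^∞` Killing `T`-commuting `Z` on `W`, NOT identically zero, with a
complete `2π`-periodic flow `Φ` on `W`, and an open `U'' ⊇ 𝓔⁺` with `U'' ∩ doc ⊆ W` on whose trace
`K = α T + β Z`, `β ≠ 0`.

**Proof.** (B0) `F_rot` applied to the collar data and h17 gives the non-rotating branch outright, or an
open `T`-invariant `V`, `𝓔⁺ ⊆ V ⊆ U`, a `C^∞` Killing `T`-commuting `Z₀` on `V` with `K = α T + β Z₀`,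
`β ≠ 0`, and a complete `2π`-periodic flow `Φ₀` of `Z₀` on `V` preserving `V ∩ doc`.  (B1) Regions: by
(R5) applied to `U₁ := V` some sub-level `{ρ₀ < c₁} ∩ doc` lies in `V`; it is non-empty (`𝓔⁺ ≠ ∅` lies in
the closure of the d.o.c., (R4)) and preconnected (R7), hence inside ONE component `N⋆` of `V ∩ doc`
(open: the carrier is locally connected).  The far region `Ω` is the union of the components of
`A_T := {x ∈ doc | g(T,T) x < 0}` through the far shell `{ρ₀ > cF} ∩ doc`; `W := N⋆ ∪ Ω` is open, inside
the d.o.c., `T`-invariant (`V ∩ doc`, `A_T` are flow-invariant and orbits are connected) and CONNECTED: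
each far component meets `{ρ₀ < c₁} ⊆ N⋆` by Timelike Reach (`isPreconnected_sUnion`).  (B2) Continuation:
every point of `W` is chartwise analytic (Müller zum Hagen with `K` on `N⋆ ⊆ U ∩ doc`, h14, and with `T`
on `Ω ⊆ A_T`, h1), so the Nomizu fact gives local Killing extensions
(`StationaryAFBlackHole.localKillingExtension_of_isChartwiseAnalyticAt`); the coherence hypothesis, docked
through `Z₀ = β⁻¹ (K - α T)` on `N⋆`, is exactly the no-monodromy clause of the continuation engine
`PseudoRiemannianMetric.IsKillingFieldOn.exists_extension_of_coherent`, which extends `Z₀|N⋆` to a `C^∞`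
Killing `T`-commuting `Z` on `W`.  (B3) Flow: orbits of `Z` through `N⋆` are `Φ₀`-orbits and stay in `N⋆`;
completeness of `Z` on `W` is `StationaryAFBlackHole.exists_isMIntegralCurve_mem_of_axialSeedData` (far
orbits are confined to level sets of `g(T,T)`, compact modulo `T` by `F_lev`, (R4), (R6), with bounded
Killing-time drift along the Chruściel–Costa time function); `2π`-periodicity holds on the open `N⋆` and
propagates to the connected `W` (`IsKillingFieldOn.exists_periodicFlow`, one-jet rigidity of isometries).
(B4) `W ⊇ doc ∖ orbit_T(S₁)` for the compact `S₁` of (R6) attached to the slab `[c₁, cF]`: below the slab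
`{ρ₀ < c₁} ⊆ N⋆`, above it Timelike Reach forces the point into `A_T`, hence into `Ω`.  (B5) Docking: with
`U'` from (R4) for `c₁`, `U'' := U' ∩ V` is open, contains `𝓔⁺`, `U'' ∩ doc ⊆ {ρ₀ < c₁} ⊆ N⋆ ⊆ W`, and there
`K = α T + β Z₀ = α T + β Z`.  (B6) If `Z ≡ 0` on `W` then `K = α T` on `U'' ∩ doc`: the non-rotating
branch; otherwise all clauses of the rotating branch are assembled.  (Idle binders: the product structure,
(R3); h7 and h11–h13 only feed `F_rot`, h4 and h5 only feed the completeness lemma and `F_lev`.)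

References: S. Alexakis, A. D. Ionescu, S. Klainerman, Geom. Funct. Anal. 20 (2010) 845–869, Thm. 1.2, Prop. 5.2
[AlexakisIonescuKlainerman2010]; P. T. Chruściel, J. L. Costa, Astérisque 321 (2008) 195–265, §2.1–2.2, §4.1–4.2,
Thm. 4.5, Thm. 4.11 [ChruscielCosta2008]; H. Müller zum Hagen, Proc. Camb. Phil. Soc. 67 (1970) 415–421
[MullerZumHagen1970]; K. Nomizu, Ann. of Math. 72 (1960) 105–120, Thms. 1–2 [Nomizu1960]; I. Rácz, R. M. Wald,
Class. Quantum Grav. 13 (1996) 539–552, Thm. 4.2 [RaczWald1996].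
-/

-- D-0017: single-problem summit, `Summit.<S>.<S>.…` by design
set_option linter.dupNamespace false

noncomputable section

namespace Summit.FinalStateConjecture.FinalStateConjecture.Theorems.NonTrappingHawkingRigidity.AzimuthalPartialAnalyticity

open Literature.Geometry.Lorentzian
open scoped Manifold ContDiff Topology
open Set Filter Bundle

/-- **Stub N1 (rev 7): the far axial seed.**  From the near-horizon dichotomy (`F_rot`), the asymptotics of
`g(T,T)` (`F_lev`), Müller zum Hagen analyticity, the `C^∞` Nomizu extension, the Chruściel–Costa time
function (the product structure is idle), the crux binders h1–h14, non-degeneracy of the collar field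
(h17), a radial function with (R1)–(R7), Timelike Reach and Killing Continuation Coherence: either the
collar is non-rotating (`K = α T` near `𝓔⁺` in the d.o.c.), or a connected open `W ⊆ doc`, co-compact
modulo `T`, carries a non-trivial `C^∞` Killing `T`-commuting field `Z` with complete `2π`-periodic flow,
to which the collar field docks as `K = α T + β Z`, `β ≠ 0`, near `𝓔⁺`.
[cite: AlexakisIonescuKlainerman2010, Thm. 1.2] [cite: ChruscielCosta2008, §4.1 and Thm. 4.5]
[cite: MullerZumHagen1970, Thm.] [cite: Nomizu1960, Theorems 1–2] -/
theorem stub_farAxialSeed :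
    alexakisIonescuKlainerman2010_nearHorizonAxialKilling → chruscielCosta2008_stationaryNormAtInfinity →
    mullerZumHagen1970_analytic_of_timelikeKilling → PseudoRiemannianMetric.Nomizu1960_killing_extension →
    chruscielCosta2008_equivariantTimeFunction → chruscielCosta2008_docProductStructure →
    ∀ (𝓑 : StationaryAFBlackHole.{0}) [𝓑.metric.HasLeviCivita],
      𝓑.metric.toPseudoRiemannianMetric.IsRicciFlat → 𝓑.IsIPlusRegular →
      (∀ p : 𝓑.carrier, p ∈ 𝓑.metric.chronologicalFuture 𝓑.timeOrientation 𝓑.Mext) →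
      (∀ p ∈ 𝓑.doc, 𝓑.killing p ≠ 0) → SimplyConnectedSpace 𝓑.doc →
      ∀ (U : Set 𝓑.carrier) (K : Π x : 𝓑.carrier, TangentSpace (𝓡 4) x), IsOpen U → 𝓑.horizon ⊆ U →
      IsConnected 𝓑.horizon →
      ContMDiffOn (𝓡 4) ((𝓡 4).prod 𝓘(ℝ, E4)) ((⊤ : ℕ∞) : WithTop ℕ∞)
        (fun x ↦ (Bundle.TotalSpace.mk' E4 x (K x) : TangentBundle (𝓡 4) 𝓑.carrier)) U →
      (∀ x ∈ U, ∀ v w : TangentSpace (𝓡 4) x,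
        𝓑.metric.val x (𝓑.metric.leviCivita K x v) w + 𝓑.metric.val x v (𝓑.metric.leviCivita K x w) = 0) →
      (∀ x ∈ U, VectorField.mlieBracket (𝓡 4) 𝓑.killing K x = 0) → (∀ p ∈ 𝓑.horizon, K p ≠ 0) →
      (∀ γ : ℝ → 𝓑.carrier, IsMIntegralCurve γ K → γ 0 ∈ 𝓑.horizon → ∀ t, γ t ∈ 𝓑.horizon) →
      (∀ x ∈ U ∩ 𝓑.doc, 𝓑.metric.val x (K x) (K x) < 0) →
      (∃ κ : ℝ, κ ≠ 0 ∧ ∀ p ∈ 𝓑.horizon, 𝓑.metric.leviCivita K p (K p) = κ • K p) →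
      ∀ ρ₀ : 𝓑.carrier → ℝ,
      (ContMDiffOn (𝓡 4) 𝓘(ℝ, ℝ) ((⊤ : ℕ∞) : WithTop ℕ∞) ρ₀ 𝓑.doc ∧
        (∀ x ∈ 𝓑.doc, mfderiv (𝓡 4) 𝓘(ℝ, ℝ) ρ₀ x (𝓑.killing x) = 0) ∧
        (∀ x ∈ 𝓑.doc, mfderiv (𝓡 4) 𝓘(ℝ, ℝ) ρ₀ x ≠ 0) ∧
        (∀ c : ℝ, 0 < c → ∃ U' : Set 𝓑.carrier, IsOpen U' ∧ 𝓑.horizon ⊆ U' ∧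
          U' ∩ 𝓑.doc = {x | x ∈ 𝓑.doc ∧ ρ₀ x < c}) ∧
        (∀ U₁ : Set 𝓑.carrier, IsOpen U₁ → 𝓑.horizon ⊆ U₁ →
          (∀ γ : ℝ → 𝓑.carrier, IsMIntegralCurve γ 𝓑.killing → γ 0 ∈ U₁ ∩ 𝓑.doc →
            ∀ t, γ t ∈ U₁ ∩ 𝓑.doc) →
          ∃ c : ℝ, 0 < c ∧ {x | x ∈ 𝓑.doc ∧ ρ₀ x < c} ⊆ U₁) ∧
        (∀ c₀ c : ℝ, 0 < c₀ → ∃ S : Set 𝓑.carrier, IsCompact S ∧ S ⊆ 𝓑.doc ∧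
          {x | x ∈ 𝓑.doc ∧ c₀ ≤ ρ₀ x ∧ ρ₀ x ≤ c} ⊆ stationaryOrbit 𝓑.killing S)) →
      (∀ c : ℝ, 0 < c → IsPreconnected {x | x ∈ 𝓑.doc ∧ ρ₀ x < c}) →
      (∃ cF : ℝ, ∀ x ∈ 𝓑.doc, cF < ρ₀ x → ∀ c : ℝ, 0 < c →
        ∃ y ∈ connectedComponentIn
            {z | z ∈ 𝓑.doc ∧ 𝓑.metric.val z (𝓑.killing z) (𝓑.killing z) < 0} x, ρ₀ y < c) →
      (∀ (D₁ D₂ : Set 𝓑.carrier) (L₁ L₂ : Π x : 𝓑.carrier, TangentSpace (𝓡 4) x),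
        IsOpen D₁ → IsConnected D₁ → IsOpen D₂ → IsConnected D₂ →
        D₁ ⊆ {z | z ∈ 𝓑.doc ∧ (𝓑.metric.val z (𝓑.killing z) (𝓑.killing z) < 0 ∨ z ∈ U)} →
        D₂ ⊆ {z | z ∈ 𝓑.doc ∧ (𝓑.metric.val z (𝓑.killing z) (𝓑.killing z) < 0 ∨ z ∈ U)} →
        𝓑.metric.toPseudoRiemannianMetric.IsKillingFieldOn L₁ D₁ →
        (∀ x ∈ D₁, VectorField.mlieBracket (𝓡 4) 𝓑.killing L₁ x = 0) →
        𝓑.metric.toPseudoRiemannianMetric.IsKillingFieldOn L₂ D₂ →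
        (∀ x ∈ D₂, VectorField.mlieBracket (𝓡 4) 𝓑.killing L₂ x = 0) →
        (∃ (a b : ℝ) (O : Set 𝓑.carrier), IsOpen O ∧ O.Nonempty ∧ O ⊆ D₁ ∩ U ∧
          ∀ x ∈ O, L₁ x = a • 𝓑.killing x + b • K x) →
        (∃ O' : Set 𝓑.carrier, IsOpen O' ∧ O'.Nonempty ∧ O' ⊆ D₁ ∩ D₂ ∧ ∀ x ∈ O', L₁ x = L₂ x) →
        ∀ x ∈ D₁ ∩ D₂, L₁ x = L₂ x) →
      (∃ U'' : Set 𝓑.carrier, IsOpen U'' ∧ 𝓑.horizon ⊆ U'' ∧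
        ∃ α : ℝ, ∀ x ∈ U'' ∩ 𝓑.doc, K x = α • 𝓑.killing x) ∨
      ∃ (W : Set 𝓑.carrier) (Z : Π x : 𝓑.carrier, TangentSpace (𝓡 4) x) (Φ : ℝ → 𝓑.carrier → 𝓑.carrier),
        (IsOpen W ∧ W ⊆ 𝓑.doc ∧
          (∃ S₁ : Set 𝓑.carrier, IsCompact S₁ ∧ S₁ ⊆ 𝓑.doc ∧
            ∀ x ∈ 𝓑.doc, x ∉ stationaryOrbit 𝓑.killing S₁ → x ∈ W) ∧
          (𝓑.metric.toPseudoRiemannianMetric.IsKillingFieldOn Z W ∧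
            ∀ x ∈ W, VectorField.mlieBracket (𝓡 4) 𝓑.killing Z x = 0) ∧
          (∀ x ∈ W, Φ 0 x = x ∧ (∀ s : ℝ, Φ s x ∈ W) ∧ (∀ s : ℝ, Φ (s + 2 * Real.pi) x = Φ s x) ∧
            IsMIntegralCurve (fun s ↦ Φ s x) Z)) ∧
        IsConnected W ∧ (∃ x ∈ W, Z x ≠ 0) ∧
        (∃ U'' : Set 𝓑.carrier, IsOpen U'' ∧ 𝓑.horizon ⊆ U'' ∧ U'' ∩ 𝓑.doc ⊆ W ∧
          ∃ α β : ℝ, β ≠ 0 ∧ ∀ x ∈ U'' ∩ 𝓑.doc, K x = α • 𝓑.killing x + β • Z x) := by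
  intro hRot hLev hMzH hNom hTime hProd 𝓑 _ h1 h2 h3 h4 h5 U K h6 h7 h8 h9 h10 h11 h12 h13 h14 h17 ρ₀ hρ hR7
    hReach hGlue
  obtain ⟨hR1, hR2, hR3, hR4, hR5, hR6⟩ := hρ
  -- B0 · the near-horizon dichotomy (named fact `F_rot`)
  rcases hRot 𝓑 h1 h2 h3 h8 U K h6 h7 h9 h10 h11 h12 h13 h14 h17 with hLeft |
    ⟨V, Z₀, Φ₀, α, β, hVo, hHV, hVU, hβ, hVT, hZ₀s, hZ₀k, hTZ₀, hdock, hΦ₀, hΦ₀doc⟩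
  · exact Or.inl hLeft
  -- notation and standing facts
  set g := 𝓑.metric.toPseudoRiemannianMetric with hg
  have hT : g.IsKillingField 𝓑.killing := 𝓑.isStationaryKilling.isKillingField
  have hdoc : IsOpen 𝓑.doc :=
    𝓑.isOpen_doc
      (LorentzianMetric.isOpen_chronologicalFuture_holds_of_boundaryless (g := 𝓑.metric)
        (τ := 𝓑.timeOrientation))
      (LorentzianMetric.isOpen_chronologicalPast_holds_of_boundaryless (g := 𝓑.metric)
        (τ := 𝓑.timeOrientation))
  set AT : Set 𝓑.carrier := {x | x ∈ 𝓑.doc ∧ 𝓑.metric.val x (𝓑.killing x) (𝓑.killing x) < 0}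
    with hAT
  have hATo : IsOpen AT :=
    hdoc.inter (isOpen_lt StationaryAFBlackHole.continuous_val_killing_killing continuous_const)
  haveI : LocallyConnectedSpace 𝓑.carrier :=
    ChartedSpace.locallyConnectedSpace (EuclideanSpace ℝ (Fin 4)) 𝓑.carrier
  -- B1a · the near-horizon component `N⋆` of `V ∩ doc` containing the sub-collar `{ρ₀ < c₁}`
  have hVdocT : ∀ γ : ℝ → 𝓑.carrier, IsMIntegralCurve γ 𝓑.killing → γ 0 ∈ V ∩ 𝓑.doc →
      ∀ t, γ t ∈ V ∩ 𝓑.doc := fun γ hγ h0 t ↦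
    ⟨hVT γ hγ h0.1 t, StationaryAFBlackHole.mem_doc_of_isMIntegralCurve hγ h0.2 t⟩
  obtain ⟨c₁, hc₁, hsub₁⟩ := hR5 V hVo hHV hVdocT
  obtain ⟨cF, hReach⟩ := hReach
  -- a point of the sub-collar (the horizon is non-empty and in the closure of the d.o.c.)
  have hsubne : ({x | x ∈ 𝓑.doc ∧ ρ₀ x < c₁} : Set 𝓑.carrier).Nonempty := by
    obtain ⟨p, hp⟩ := h8.nonempty
    obtain ⟨U', hU'o, hHU', hU'eq⟩ := hR4 c₁ hc₁
    have hpcl : p ∈ closure 𝓑.doc :=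
      𝓑.horizon_subset_closure_doc
        (LorentzianMetric.isOpen_chronologicalFuture_holds_of_boundaryless (g := 𝓑.metric)
          (τ := 𝓑.timeOrientation))
        (LorentzianMetric.isOpen_chronologicalPast_holds_of_boundaryless (g := 𝓑.metric)
          (τ := 𝓑.timeOrientation)) hp
    obtain ⟨y, hyU', hyd⟩ := mem_closure_iff.1 hpcl U' hU'o (hHU' hp)
    have hy : y ∈ U' ∩ 𝓑.doc := ⟨hyU', hyd⟩
    rw [hU'eq] at hy
    exact ⟨y, hy⟩
  obtain ⟨x₁, hx₁⟩ := hsubne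
  set Nstar : Set 𝓑.carrier := connectedComponentIn (V ∩ 𝓑.doc) x₁ with hNstar
  have hNo : IsOpen Nstar := (hVo.inter hdoc).connectedComponentIn
  have hNc : IsConnected Nstar := isConnected_connectedComponentIn_iff.2 ⟨hsub₁ hx₁, hx₁.1⟩
  have hNV : Nstar ⊆ V ∩ 𝓑.doc := connectedComponentIn_subset _ _
  have hsubN : {x | x ∈ 𝓑.doc ∧ ρ₀ x < c₁} ⊆ Nstar :=
    (hR7 c₁ hc₁).subset_connectedComponentIn hx₁ fun x hx ↦ ⟨hsub₁ hx, hx.1⟩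
  -- a continuous curve in a set stays in the component of its starting point
  have hcurve : ∀ (F : Set 𝓑.carrier) (γ : ℝ → 𝓑.carrier), Continuous γ → (∀ t, γ t ∈ F) →
      ∀ t, γ t ∈ connectedComponentIn F (γ 0) := fun F γ hγc hγF t ↦
    ((isPreconnected_range hγc).subset_connectedComponentIn (mem_range_self 0)
      (range_subset_iff.2 hγF)) (mem_range_self t)
  have hcurveN : ∀ γ : ℝ → 𝓑.carrier, Continuous γ → (∀ t, γ t ∈ V ∩ 𝓑.doc) → γ 0 ∈ Nstar →
      ∀ t, γ t ∈ Nstar := by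
    intro γ hγc hγF h0 t
    have h := hcurve (V ∩ 𝓑.doc) γ hγc hγF t
    rwa [← connectedComponentIn_eq h0] at h
  -- B1b · the far region: the components of `A_T` through the far shell `{ρ₀ > cF}`
  set Ω : Set 𝓑.carrier := ⋃ x ∈ {x | x ∈ 𝓑.doc ∧ cF < ρ₀ x}, connectedComponentIn AT x with hΩ
  have hΩo : IsOpen Ω := isOpen_biUnion fun x _ ↦ hATo.connectedComponentIn
  have hΩAT : Ω ⊆ AT := iUnion₂_subset fun x _ ↦ connectedComponentIn_subset _ _
  -- B1c · the seed domain
  set W : Set 𝓑.carrier := Nstar ∪ Ω with hW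
  have hWo : IsOpen W := hNo.union hΩo
  have hWdoc : W ⊆ 𝓑.doc := union_subset (fun x hx ↦ (hNV hx).2) fun x hx ↦ (hΩAT hx).1
  have hWc : IsConnected W := by
    -- every component of `A_T` through a far point meets `{ρ₀ < c₁} ⊆ N⋆` (TimelikeReach)
    refine ⟨⟨x₁, subset_union_left (hsubN hx₁)⟩, ?_⟩
    set 𝒞 : Set (Set 𝓑.carrier) :=
      insert Nstar ((fun x ↦ Nstar ∪ connectedComponentIn AT x) '' {x | x ∈ 𝓑.doc ∧ cF < ρ₀ x})
      with h𝒞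
    have hW𝒞 : W = ⋃₀ 𝒞 := by
      apply Subset.antisymm
      · rintro z (hz | hz)
        · exact ⟨Nstar, mem_insert _ _, hz⟩
        · obtain ⟨x, hx, hzx⟩ := mem_iUnion₂.1 hz
          exact ⟨Nstar ∪ connectedComponentIn AT x, mem_insert_of_mem _ ⟨x, hx, rfl⟩, Or.inr hzx⟩
      · rintro z ⟨C, hC, hzC⟩
        rcases hC with rfl | ⟨x, hx, rfl⟩
        · exact Or.inl hzC
        · rcases hzC with hzC | hzC
          · exact Or.inl hzC
          · exact Or.inr (mem_iUnion₂.2 ⟨x, hx, hzC⟩)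
    rw [hW𝒞]
    refine isPreconnected_sUnion x₁ 𝒞 (fun C hC ↦ ?_) fun C hC ↦ ?_
    · rcases hC with rfl | ⟨x, -, rfl⟩
      · exact hsubN hx₁
      · exact Or.inl (hsubN hx₁)
    · rcases hC with rfl | ⟨x, hx, rfl⟩
      · exact hNc.isPreconnected
      · -- `comp(x)` meets `N⋆` at a point of `{ρ₀ < c₁}` given by TimelikeReach
        obtain ⟨y, hy, hyc⟩ := hReach x hx.1 hx.2 c₁ hc₁
        have hyN : y ∈ Nstar := hsubN ⟨(connectedComponentIn_subset _ _ hy).1, hyc⟩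
        exact (IsPreconnected.union y hyN hy hNc.isPreconnected isPreconnected_connectedComponentIn)
  have hATT : ∀ γ : ℝ → 𝓑.carrier, IsMIntegralCurve γ 𝓑.killing → γ 0 ∈ AT → ∀ t, γ t ∈ AT :=
    fun γ hγ h0 t ↦ ⟨StationaryAFBlackHole.mem_doc_of_isMIntegralCurve hγ h0.1 t, by
      have h := hT.val_self_apply_eq_of_isMIntegralCurve hγ t 0
      show 𝓑.metric.val (γ t) (𝓑.killing (γ t)) (𝓑.killing (γ t)) < 0
      rw [show 𝓑.metric.val (γ t) (𝓑.killing (γ t)) (𝓑.killing (γ t)) =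
        g.val (γ t) (𝓑.killing (γ t)) (𝓑.killing (γ t)) from rfl, h]
      exact h0.2⟩
  have hWT : ∀ γ : ℝ → 𝓑.carrier, IsMIntegralCurve γ 𝓑.killing → γ 0 ∈ W → ∀ t, γ t ∈ W := by
    -- `V ∩ doc`, `A_T`, `doc` are `T`-invariant and orbits are connected
    intro γ hγ h0 t
    rcases h0 with h0 | h0
    · exact subset_union_left (hcurveN γ hγ.continuous (hVdocT γ hγ (hNV h0)) h0 t)
    · obtain ⟨x, hx, hγx⟩ := mem_iUnion₂.1 h0
      have h := hcurve AT γ hγ.continuous (hATT γ hγ (connectedComponentIn_subset _ _ hγx)) t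
      rw [← connectedComponentIn_eq hγx] at h
      exact subset_union_right (mem_iUnion₂.2 ⟨x, hx, h⟩)
  -- B2 · continuation of `Z₀` from `N⋆` to `W` (engine p157974; local Nomizu p158179; MzH; Glue)
  have han : ∀ x ∈ W, 𝓑.IsChartwiseAnalyticAt x := by
    -- on `Ω ⊆ A_T`: Müller zum Hagen with `T`; on `N⋆ ⊆ U ∩ doc`: with `K` (h14)
    intro x hx
    rcases hx with hx | hx
    · obtain ⟨ψ, hψ, hxψ, hA⟩ := hMzH 𝓑 h1 U K h6 h9 h10 x (hVU (hNV hx).1)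
        (h14 x ⟨hVU (hNV hx).1, (hNV hx).2⟩)
      exact ⟨ψ, hψ, hxψ, hA⟩
    · have hxAT := hΩAT hx
      obtain ⟨ψ, hψ, hxψ, hA⟩ := hMzH 𝓑 h1 𝓑.doc 𝓑.killing hdoc hT.contMDiff.contMDiffOn
        (fun y _ v w ↦ hT.val_leviCivita_add y v w) x hxAT.1 hxAT.2
      exact ⟨ψ, hψ, hxψ, hA⟩
  have hZ₀N : g.IsKillingFieldOn Z₀ Nstar := ⟨hZ₀s.mono fun x hx ↦ (hNV hx).1,
    fun x hx ↦ hZ₀k x (hNV hx).1⟩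
  obtain ⟨Z, hZK, hTZ, hZN⟩ :=
    PseudoRiemannianMetric.IsKillingFieldOn.exists_extension_of_coherent (T := 𝓑.killing)
      hWo hWc hNo hNc subset_union_left hZ₀N (fun x hx ↦ hTZ₀ x (hNV hx).1)
      (𝓑.localKillingExtension_of_isChartwiseAnalyticAt hNom hWo han)
      (by
        -- the coherence bet, docked through `Z₀ = β⁻¹ (K - α T)` on `N⋆ ⊆ U`
        intro D₁ D₂ L₁ L₂ hD₁o hD₁c hD₂o hD₂c hD₁W hD₂W hND₁ hL₁N hL₁K hL₁T hL₂K hL₂T hagree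
        have hamb : W ⊆ {z | z ∈ 𝓑.doc ∧
            (𝓑.metric.val z (𝓑.killing z) (𝓑.killing z) < 0 ∨ z ∈ U)} := by
          intro z hz
          rcases hz with hz | hz
          · exact ⟨(hNV hz).2, Or.inr (hVU (hNV hz).1)⟩
          · exact ⟨(hΩAT hz).1, Or.inl (hΩAT hz).2⟩
        refine hGlue D₁ D₂ L₁ L₂ hD₁o hD₁c hD₂o hD₂c (hD₁W.trans hamb) (hD₂W.trans hamb)
          hL₁K hL₁T hL₂K hL₂T ⟨-(β⁻¹ * α), β⁻¹, Nstar, hNo, ⟨x₁, hsubN hx₁⟩,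
            fun z hz ↦ ⟨hND₁ hz, hVU (hNV hz).1⟩, fun z hz ↦ ?_⟩ hagree
        rw [hL₁N z hz, hdock z (hNV hz).1, smul_add, smul_smul, smul_smul, inv_mul_cancel₀ hβ,
          one_smul]
        module)
  -- B3 · the complete `2π`-periodic flow of `Z` on `W` (p158803, p159066, p159204, p157760, `F_lev`)
  have hΦN : ∀ x ∈ Nstar, Φ₀ 0 x = x ∧ (∀ s : ℝ, Φ₀ s x ∈ Nstar) ∧
      IsMIntegralCurve (fun s ↦ Φ₀ s x) Z := by
    intro x hx
    obtain ⟨h0, hmemV, -, hint⟩ := hΦ₀ x (hNV hx).1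
    have hmem : ∀ s, Φ₀ s x ∈ V ∩ 𝓑.doc := fun s ↦ ⟨hmemV s, hΦ₀doc x (hNV hx) s⟩
    have h0N : (fun s ↦ Φ₀ s x) 0 ∈ Nstar := by simpa [h0] using hx
    have hN : ∀ s, Φ₀ s x ∈ Nstar := hcurveN (fun s ↦ Φ₀ s x) hint.continuous hmem h0N
    refine ⟨h0, hN, fun s ↦ ?_⟩
    have h := hint s
    rwa [← hZN _ (hN s)] at h
  have hcomplete : ∀ x ∈ W, ∃ γ : ℝ → 𝓑.carrier, γ 0 = x ∧ IsMIntegralCurve γ Z ∧ ∀ s, γ s ∈ W := by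
    -- p161478: orbits through `N⋆` are `Φ₀`-orbits; far orbits are confined (level sets of `g(T,T)`
    -- compact modulo `T` by `F_lev` + (R4)–(R6); Killing time drifts at bounded rate)
    obtain ⟨tf, htfs, -, htfeq⟩ := hTime 𝓑 h2
    obtain ⟨v, -, hlev⟩ := hLev 𝓑 h1 h2 h5 h8
    refine 𝓑.exists_isMIntegralCurve_mem_of_axialSeedData h4 hlev htfs
      (fun γ hγ h0 s ↦ htfeq γ hγ (Or.inl h0) s) hR1 hR2 hR4 hR6 hWo hWdoc hWT
      subset_union_left hZK hTZ hΦN hc₁ hsubN fun x hx hxN ↦ ?_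
    have hxΩ : x ∈ Ω := hx.resolve_left hxN
    refine ⟨(hΩAT hxΩ).2, ?_⟩
    obtain ⟨x', hx', hxx'⟩ := mem_iUnion₂.1 hxΩ
    have h := connectedComponentIn_eq hxx'
    intro z hz
    exact subset_union_right (mem_iUnion₂.2 ⟨x', hx', by rw [h]; exact hz⟩)
  have hper : ∃ O : Set 𝓑.carrier, IsOpen O ∧ O.Nonempty ∧ O ⊆ W ∧
      ∀ x ∈ O, ∃ γ : ℝ → 𝓑.carrier, γ 0 = x ∧ IsMIntegralCurve γ Z ∧ (∀ s, γ s ∈ W) ∧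
        ∀ s, γ (s + 2 * Real.pi) = γ s := by
    refine ⟨Nstar, hNo, ⟨x₁, hsubN hx₁⟩, subset_union_left, fun x hx ↦ ?_⟩
    obtain ⟨h0, hN, hint⟩ := hΦN x hx
    exact ⟨fun s ↦ Φ₀ s x, h0, hint, fun s ↦ subset_union_left (hN s),
      (hΦ₀ x (hNV hx).1).2.2.1⟩
  obtain ⟨Φ, hΦW, hΦadd, hΦoff⟩ :=
    PseudoRiemannianMetric.IsKillingFieldOn.exists_periodicFlow hWo hWc hZK hcomplete hper
  -- B4 · `W` contains the complement of the `T`-orbit of a compact slab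
  obtain ⟨S₁, hS₁c, hS₁doc, hslab⟩ := hR6 c₁ cF hc₁
  have hWbig : ∀ x ∈ 𝓑.doc, x ∉ stationaryOrbit 𝓑.killing S₁ → x ∈ W := by
    intro x hx hxS
    by_cases hlt : ρ₀ x < c₁
    · exact subset_union_left (hsubN ⟨hx, hlt⟩)
    · have hgt : cF < ρ₀ x := by
        by_contra hle
        exact hxS (hslab ⟨hx, not_lt.1 hlt, not_lt.1 hle⟩)
      -- `TimelikeReach` forces `x ∈ A_T`, and `x` lies in its own component
      obtain ⟨y, hy, -⟩ := hReach x hx hgt c₁ hc₁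
      have hxAT : x ∈ AT := by
        by_contra hxAT
        rw [connectedComponentIn_eq_empty hxAT] at hy
        exact hy
      exact subset_union_right (mem_iUnion₂.2 ⟨x, ⟨hx, hgt⟩, mem_connectedComponentIn hxAT⟩)
  -- B5 · docking near the horizon on an open `U'' ⊇ 𝓔⁺` with `U'' ∩ doc ⊆ N⋆`
  have hdockN : ∃ U'' : Set 𝓑.carrier, IsOpen U'' ∧ 𝓑.horizon ⊆ U'' ∧ U'' ∩ 𝓑.doc ⊆ W ∧
      ∃ α' β' : ℝ, β' ≠ 0 ∧ ∀ x ∈ U'' ∩ 𝓑.doc, K x = α' • 𝓑.killing x + β' • Z x := by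
    obtain ⟨U', hU'o, hHU', hU'eq⟩ := hR4 c₁ hc₁
    refine ⟨U' ∩ V, hU'o.inter hVo, subset_inter hHU' hHV, ?_, α, β, hβ, fun x hx ↦ ?_⟩
    · intro x hx
      have hx' : x ∈ U' ∩ 𝓑.doc := ⟨hx.1.1, hx.2⟩
      rw [hU'eq] at hx'
      exact subset_union_left (hsubN hx')
    · have hx' : x ∈ U' ∩ 𝓑.doc := ⟨hx.1.1, hx.2⟩
      rw [hU'eq] at hx'
      rw [hdock x hx.1.2, hZN x (hsubN hx')]
  -- B6 · assembly (and `Z ≢ 0`, else the non-rotating branch)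
  by_cases hZne : ∃ x ∈ W, Z x ≠ 0
  · exact Or.inr ⟨W, Z, Φ, ⟨hWo, hWdoc, ⟨S₁, hS₁c, hS₁doc, hWbig⟩, ⟨hZK, hTZ⟩, hΦW⟩, hWc, hZne, hdockN⟩
  · push Not at hZne
    obtain ⟨U'', hU''o, hHU'', hU''W, α', β', -, hK⟩ := hdockN
    refine Or.inl ⟨U'', hU''o, hHU'', α', fun x hx ↦ ?_⟩
    rw [hK x hx, hZne x (hU''W hx), smul_zero, add_zero]

end Summit.FinalStateConjecture.FinalStateConjecture.Theorems.NonTrappingHawkingRigidity.AzimuthalPartialAnalyticity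

end
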